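import Summits.NavierStokesRegularity.NavierStokesRegularity.Theorems.PerpetualPumpThesisBilinearOperator
import Summits.NavierStokesRegularity.NavierStokesRegularity.Theorems.PerpetualPumpEulerTypeIGlueDuhamel

/-!
# Stub U (`uniqueness`) for `PerpetualPump.Thesis`, part II: the Duhamel integrand of the averaged
# mild formulation is continuous in time

Support file (part 2 of the stub `uniqueness` of line `SketchIdeator2`, crux
stmt-NavierStokesRegularity-1832). In Tao's mild formulation (J. Amer. Math. Soc. 29 (2016),
arXiv:1402.0290v3, §1.1 (1.15)) of the averaged equation `∂ₜu = Δu + B̃(u,u)` the Duhamel term is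
the time integral `∫₀ᵗ ⟨B̃(u(s),u(s)), e^{(t-s)Δ} w⟩ ds`, rendered in the tree as an interval
(Bochner) integral, so every manipulation of it (splitting, subtracting two solutions) needs the
integrand to be integrable. This file proves, for an *arbitrary* averaging datum `𝒜`:

* differences of the trilinear form `𝒜.form = ⟨B̃(·,·), ·⟩` in each slot on fields of finite `H¹⁰`
  norm (`form_sub₁`, `form_sub₂`, `form_sub₃`) and the splitting
  `⟨B̃(x,x), h⟩ - ⟨B̃(y,y), h⟩ = ⟨B̃(x-y,x), h⟩ + ⟨B̃(y,x-y), h⟩` (`form_sub_form`), from the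
  trilinearity of part III of stub B;
* the real-valued tame bound `|⟨B̃(u,v), w⟩| ≤ K ‖u‖_{H¹⁰} ‖v‖_{H¹⁰} ‖w‖_{L²}` (`norm_form_le_real`);
* **continuity of `s ↦ ⟨B̃(v(s),v(s)), e^{(t-s)Δ} w⟩`** on any time set on which `v` is
  `H¹⁰`-continuous and `H¹⁰`-bounded (`continuousOn_form_heat`, registered sub-goal
  `stub_uniqueness_Continuity`), hence interval integrability on compact sub-intervals
  (`intervalIntegrable_form_heat`) — the averaged analogue of the tree's
  `continuousOn_eulerForm_heat` (same three-term splitting, with the strong continuity of `e^{τΔ}`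
  on `L²`).

## References

* T. Tao, J. Amer. Math. Soc. 29 (2016), 601–674, arXiv:1402.0290v3, §1.1 (1.12)–(1.15), p. 7.
-/

noncomputable section

open MeasureTheory Set Filter Topology
open scoped ENNReal NNReal

set_option linter.dupNamespace false

namespace Summit.NavierStokesRegularity.NavierStokesRegularity.Theorems.PerpetualPumpThesis.U

open Literature.Analysis.FluidPDE Literature.Analysis.FluidPDE.Tao2016
open Literature.Analysis.FunctionSpaces (eFourierSobolevNorm)
open Summit.NavierStokesRegularity.NavierStokesRegularity.Theorems.PerpetualPumpEulerTypeIGlue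
  (continuous_heat_apply norm_heat_le eFourierSobolevNorm_sub_lt_top)

/-! ### Differences of the averaged form -/

/-- `⟨B̃(x,v), h⟩ - ⟨B̃(x',v), h⟩ = ⟨B̃(x - x',v), h⟩` on fields of finite `H¹⁰` norm. -/
theorem form_sub₁ (𝒜 : AveragingDatum) {x x' v : L2C} (h : L2C) (hx : eFourierSobolevNorm 10 x < ⊤)
    (hx' : eFourierSobolevNorm 10 x' < ⊤) (hv : eFourierSobolevNorm 10 v < ⊤) :
    𝒜.form x v h - 𝒜.form x' v h = 𝒜.form (x - x') v h := by
  have hxx' : eFourierSobolevNorm 10 (x - x') < ⊤ := eFourierSobolevNorm_sub_lt_top hx hx'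
  have h1 := B.form_add₁ 𝒜 h hxx' hx' hv
  rw [sub_add_cancel] at h1
  rw [h1, add_sub_cancel_right]

/-- `⟨B̃(u,y), h⟩ - ⟨B̃(u,y'), h⟩ = ⟨B̃(u,y - y'), h⟩` on fields of finite `H¹⁰` norm. -/
theorem form_sub₂ (𝒜 : AveragingDatum) {u y y' : L2C} (h : L2C) (hu : eFourierSobolevNorm 10 u < ⊤)
    (hy : eFourierSobolevNorm 10 y < ⊤) (hy' : eFourierSobolevNorm 10 y' < ⊤) :
    𝒜.form u y h - 𝒜.form u y' h = 𝒜.form u (y - y') h := by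
  have hyy' : eFourierSobolevNorm 10 (y - y') < ⊤ := eFourierSobolevNorm_sub_lt_top hy hy'
  have h1 := B.form_add₂ 𝒜 h hu hyy' hy'
  rw [sub_add_cancel] at h1
  rw [h1, add_sub_cancel_right]

/-- `⟨B̃(u,v), z⟩ - ⟨B̃(u,v), z'⟩ = ⟨B̃(u,v), z - z'⟩` for `u, v` of finite `H¹⁰` norm. -/
theorem form_sub₃ (𝒜 : AveragingDatum) {u v : L2C} (z z' : L2C) (hu : eFourierSobolevNorm 10 u < ⊤)
    (hv : eFourierSobolevNorm 10 v < ⊤) :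
    𝒜.form u v z - 𝒜.form u v z' = 𝒜.form u v (z - z') := by
  have h1 := B.form_add₃ 𝒜 (z - z') z' hu hv
  rw [sub_add_cancel] at h1
  rw [h1, add_sub_cancel_right]

/-- **The splitting of the difference of two quadratic terms**:
`⟨B̃(x,x), h⟩ - ⟨B̃(y,y), h⟩ = ⟨B̃(x-y,x), h⟩ + ⟨B̃(y,x-y), h⟩` on fields of finite `H¹⁰` norm
(the identity behind the energy estimate for the difference of two mild solutions). -/
theorem form_sub_form (𝒜 : AveragingDatum) {x y : L2C} (h : L2C) (hx : eFourierSobolevNorm 10 x < ⊤)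
    (hy : eFourierSobolevNorm 10 y < ⊤) :
    𝒜.form x x h - 𝒜.form y y h = 𝒜.form (x - y) x h + 𝒜.form y (x - y) h := by
  rw [← form_sub₁ 𝒜 h hx hy hx, ← form_sub₂ 𝒜 h hy hx hy]
  ring

/-! ### The real-valued tame bound -/

/-- **Real-valued tame bound**: `|⟨B̃(u,v), w⟩| ≤ K ‖u‖_{H¹⁰} ‖v‖_{H¹⁰} ‖w‖_{L²}` for `u, v` of finite
`H¹⁰` norm, given the `H¹⁰ × H¹⁰ × H⁻⁹` bound of stub B with constant `K`. -/
theorem norm_form_le_real (𝒜 : AveragingDatum) {K9 : ℝ≥0}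
    (hK9 : ∀ u v w : L2C, eFourierSobolevNorm 10 u < ⊤ → eFourierSobolevNorm 10 v < ⊤ →
      ‖𝒜.form u v w‖ₑ ≤ (K9 : ℝ≥0∞) * eFourierSobolevNorm 10 u * eFourierSobolevNorm 10 v *
        eFourierSobolevNorm (-9) w)
    {u v : L2C} (hu : eFourierSobolevNorm 10 u < ⊤) (hv : eFourierSobolevNorm 10 v < ⊤) (w : L2C) :
    ‖𝒜.form u v w‖ ≤ (K9 : ℝ) * (eFourierSobolevNorm 10 u).toReal * (eFourierSobolevNorm 10 v).toReal *
      ‖w‖ := by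
  have h := B.norm_form_le 𝒜 hK9 hu hv w
  rwa [ENNReal.toReal_mul, ENNReal.toReal_mul, ENNReal.coe_toReal] at h

/-! ### Continuity of the Duhamel integrand -/

/-- **The Duhamel integrand `s ↦ ⟨B̃(v(s),v(s)), e^{(t-s)Δ} w⟩` is continuous** on a time set on
which `v` is `H¹⁰`-continuous with `H¹⁰` norms bounded by `M`, for every averaging datum (Tao
2016, p. 7: the averaged form converges absolutely on `H¹⁰ × H¹⁰ × L²`; plus the strong
continuity of `e^{τΔ}` on `L²`). -/
theorem continuousOn_form_heat (𝒜 : AveragingDatum) {I : Set ℝ} {v : ℝ → L2C}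
    (hv : ContinuousInH10On I v) {M : ℝ} (hM : ∀ s ∈ I, eFourierSobolevNorm 10 (v s) ≤ ENNReal.ofReal M)
    (w : L2C) (t : ℝ) :
    ContinuousOn (fun s => 𝒜.form (v s) (v s) (heat (t - s) w)) I := by
  obtain ⟨K9, hK9⟩ := B.exists_enorm_form_le 𝒜
  set K : ℝ := (K9 : ℝ) with hK
  have hK0 : 0 ≤ K := K9.coe_nonneg
  have hfin : ∀ s ∈ I, eFourierSobolevNorm 10 (v s) < ⊤ := fun s hs =>
    lt_of_le_of_lt (hM s hs) ENNReal.ofReal_lt_top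
  have hreal : ∀ s ∈ I, (eFourierSobolevNorm 10 (v s)).toReal ≤ max M 0 := fun s hs => by
    have := ENNReal.toReal_mono ENNReal.ofReal_ne_top (hM s hs)
    refine this.trans ?_
    by_cases h : 0 ≤ M
    · rw [ENNReal.toReal_ofReal h]; exact le_max_left _ _
    · rw [ENNReal.ofReal_of_nonpos (not_le.1 h).le, ENNReal.toReal_zero]; exact le_max_right _ _
  intro s₀ hs₀
  rw [ContinuousWithinAt, tendsto_iff_norm_sub_tendsto_zero]
  set M' : ℝ := max M 0 with hM'
  have hM'0 : 0 ≤ M' := le_max_right _ _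
  -- the three-term decomposition and its bound
  have hbound : ∀ s ∈ I, ‖𝒜.form (v s) (v s) (heat (t - s) w) - 𝒜.form (v s₀) (v s₀) (heat (t - s₀) w)‖ ≤
      K * (eFourierSobolevNorm 10 (v s - v s₀)).toReal * M' * ‖w‖ +
      K * M' * (eFourierSobolevNorm 10 (v s - v s₀)).toReal * ‖w‖ +
      K * M' * M' * ‖heat (t - s) w - heat (t - s₀) w‖ := by
    intro s hs
    have e1 := form_sub_form 𝒜 (heat (t - s) w) (hfin s hs) (hfin s₀ hs₀)
    have e3 := form_sub₃ 𝒜 (heat (t - s) w) (heat (t - s₀) w) (hfin s₀ hs₀) (hfin s₀ hs₀)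
    have hdec : 𝒜.form (v s) (v s) (heat (t - s) w) - 𝒜.form (v s₀) (v s₀) (heat (t - s₀) w) =
        𝒜.form (v s - v s₀) (v s) (heat (t - s) w) + 𝒜.form (v s₀) (v s - v s₀) (heat (t - s) w) +
          𝒜.form (v s₀) (v s₀) (heat (t - s) w - heat (t - s₀) w) := by
      rw [← e1, ← e3]; ring
    rw [hdec]
    have hsub := eFourierSobolevNorm_sub_lt_top (hfin s hs) (hfin s₀ hs₀)
    refine (norm_add₃_le).trans (add_le_add_three ?_ ?_ ?_)
    · refine (norm_form_le_real 𝒜 hK9 hsub (hfin s hs) _).trans ?_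
      have h1 := hreal s hs
      have h2 := norm_heat_le (t - s) w
      gcongr
    · refine (norm_form_le_real 𝒜 hK9 (hfin s₀ hs₀) hsub _).trans ?_
      have h1 := hreal s₀ hs₀
      have h2 := norm_heat_le (t - s) w
      gcongr
    · refine (norm_form_le_real 𝒜 hK9 (hfin s₀ hs₀) (hfin s₀ hs₀) _).trans ?_
      have h1 := hreal s₀ hs₀
      gcongr
  -- the two vanishing quantities
  have hH10 : Tendsto (fun s => (eFourierSobolevNorm 10 (v s - v s₀)).toReal) (𝓝[I] s₀) (𝓝 0) := by
    have h := (ENNReal.tendsto_toReal ENNReal.zero_ne_top).comp (hv s₀ hs₀)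
    rw [ENNReal.toReal_zero] at h
    exact h.congr fun s => rfl
  have hheat : Tendsto (fun s => ‖heat (t - s) w - heat (t - s₀) w‖) (𝓝[I] s₀) (𝓝 0) := by
    have hc : Continuous fun s : ℝ => heat (t - s) w :=
      (continuous_heat_apply w).comp (continuous_const.sub continuous_id)
    have := ((hc.tendsto s₀).sub_const (heat (t - s₀) w)).norm
    simp only [sub_self, norm_zero] at this
    exact this.mono_left nhdsWithin_le_nhds
  have hrhs : Tendsto (fun s => K * (eFourierSobolevNorm 10 (v s - v s₀)).toReal * M' * ‖w‖ +
      K * M' * (eFourierSobolevNorm 10 (v s - v s₀)).toReal * ‖w‖ +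
      K * M' * M' * ‖heat (t - s) w - heat (t - s₀) w‖) (𝓝[I] s₀) (𝓝 0) := by
    have h1 : Tendsto (fun s => K * (eFourierSobolevNorm 10 (v s - v s₀)).toReal * M' * ‖w‖) (𝓝[I] s₀)
        (𝓝 (K * 0 * M' * ‖w‖)) := ((hH10.const_mul K).mul_const M').mul_const ‖w‖
    have h2 : Tendsto (fun s => K * M' * (eFourierSobolevNorm 10 (v s - v s₀)).toReal * ‖w‖) (𝓝[I] s₀)
        (𝓝 (K * M' * 0 * ‖w‖)) := (hH10.const_mul (K * M')).mul_const ‖w‖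
    have h3 : Tendsto (fun s => K * M' * M' * ‖heat (t - s) w - heat (t - s₀) w‖) (𝓝[I] s₀)
        (𝓝 (K * M' * M' * 0)) := hheat.const_mul (K * M' * M')
    simpa using (h1.add h2).add h3
  refine squeeze_zero_norm' ?_ hrhs
  filter_upwards [self_mem_nhdsWithin] with s hs
  rw [norm_norm]
  exact hbound s hs

/-- Consequently the Duhamel integrand is interval integrable on every `[t₁, t₂] ⊆ I`. -/
theorem intervalIntegrable_form_heat (𝒜 : AveragingDatum) {I : Set ℝ} {v : ℝ → L2C}
    (hv : ContinuousInH10On I v) {M : ℝ} (hM : ∀ s ∈ I, eFourierSobolevNorm 10 (v s) ≤ ENNReal.ofReal M)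
    (w : L2C) (t : ℝ) {t₁ t₂ : ℝ} (ht : uIcc t₁ t₂ ⊆ I) :
    IntervalIntegrable (fun s => 𝒜.form (v s) (v s) (heat (t - s) w)) volume t₁ t₂ :=
  ((continuousOn_form_heat 𝒜 hv hM w t).mono ht).intervalIntegrable

end Summit.NavierStokesRegularity.NavierStokesRegularity.Theorems.PerpetualPumpThesis.U

namespace Summit.NavierStokesRegularity.NavierStokesRegularity.Theorems.PerpetualPumpThesis

open Literature.Analysis.FluidPDE Literature.Analysis.FluidPDE.Tao2016
open Literature.Analysis.FunctionSpaces (eFourierSobolevNorm)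

/-- **Part Continuity of stub U (registered sub-goal `stub_uniqueness_Continuity`)**: for every
averaging datum `𝒜`, every curve `v` that is `H¹⁰`-continuous and `H¹⁰`-bounded on a time set `I`,
every `w ∈ L²(ℝ³; ℂ³)` and every `t`, the Duhamel integrand of Tao's averaged mild formulation
(1.15), `s ↦ ⟨B̃(v(s),v(s)), e^{(t-s)Δ} w⟩`, is continuous on `I`. -/
theorem stub_uniqueness_Continuity : ∀ (𝒜 : AveragingDatum) (I : Set ℝ) (v : ℝ → L2C) (M : ℝ) (w : L2C) (t : ℝ), ContinuousInH10On I v → (∀ s ∈ I, eFourierSobolevNorm 10 (v s) ≤ ENNReal.ofReal M) → ContinuousOn (fun s => 𝒜.form (v s) (v s) (heat (t - s) w)) I :=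
  fun 𝒜 _ _ _ w t hv hM => U.continuousOn_form_heat 𝒜 hv hM w t

end Summit.NavierStokesRegularity.NavierStokesRegularity.Theorems.PerpetualPumpThesis
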